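import Summits.ResolutionOfSingularities.ResolutionOfSingularities.Theorems.EquisingularLiftCampaignW45bBlowupStalkDictionary
import Literature.AlgebraicGeometry.Resolution.BlowupAlgebraQuasiRegularChart
import Literature.AlgebraicGeometry.Resolution.StalkIdealLemmas
import Literature.AlgebraicGeometry.Resolution.MarkedIdealsLemmas
import Literature.AlgebraicGeometry.Resolution.ComponentGluing
import Literature.AlgebraicGeometry.Resolution.AlterationsNodalBoundary
import HarnessLib

/-!
# [OURS · L1 W4.5(b) · EL♮(3)] THE EXCEPTIONAL DIVISOR OF THE BLOW-UP OF A REDUCED QUASI-REGULAR CENTRE IS REDUCED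
# `𝓘⟨Z⟩ · 𝒪_{Bl_Z} = 𝓘⟨υ⁻¹ Z⟩` (tower assembly HSUB′(ReachTower₀)₃: exactness clause (e-i) of `Tower.Inv₁` for every NEW exceptional surface)

res-D-pv-029 g8 (HSUB′(ReachTower)₃ ASSEMBLY, res-L1-w45b-plan-1 NAMING 2026-08-27T16:17:51Z). OURS; NOT a statement of any manuscript;
AI-written, weaker than expert review. No `sorry`; standard axioms. DEF-FREE. `--supports stmt-ResolutionOfSingularities-20148 --as helper`.

WHAT. `comap_vanishingIdeal_eq_vanishingIdeal_preimage`: for a blow-up `υ : G' → G` of the REDUCED closed subscheme on a closed `Z ⊆ G`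
(`IsBlowup υ 𝓘⟨Z⟩`) whose ideal is generated at every point of `Z` by a QUASI-REGULAR sequence (the curves of the tower: the carrier
`Z₉ = V(σ̄, κ̄)` after the in-carrier steps, a cone witness `E ∩ closure K`, a regular section `Γ` — all complete intersections in the
regular ambient), the total transform IS the reduced structure on the preimage: `𝓘⟨Z⟩.comap υ = 𝓘⟨υ⁻¹ Z⟩` — i.e. the exceptional divisor
`E = V(𝓘⟨Z⟩·𝒪_{G'})` is REDUCED. Used three times by the tower assembly (…NatTowerInvDefs `Tower.Inv₁` (e-i)): the seed surface
`υ'⁻¹ Z₉` of the curve step, the new surface `υ₂⁻¹ Z` of a Čech or cone round (with res-D-pv-051's `coneRound_newExceptional_comap`,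
p549332, which stops at the total transform `(vanishingIdeal Z).comap υ`).
PROOF: stalkwise; over `z ∈ Z` the stalk `𝒪_{G',x'}` is a localisation `B_𝔔` of the chart algebra `B = 𝒪_{G,z}[I/c_j]`
(`exists_blowupAlgebra_stalk_ringEquiv_of_eq`, …W45bBlowupStalkDictionary) with `(𝓘⟨Z⟩·𝒪)_x' = (c_j/1)`, and `B ⧸ (c_j) ≅ (𝒪_{G,z} ⧸ I)[T_l : l ≠ j]`
for `c` quasi-regular (Stacks 0BIQ, `blowupAlgebraQuotEquiv`) is a polynomial ring over the REDUCED ring `𝒪_{G,z} ⧸ 𝓘⟨Z⟩_z`, hence reduced;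
so `(c_j)` is radical in `B`, in `B_𝔔`, in `𝒪_{G',x'}`; off `Z` the stalk is `⊤`. Then `𝓘⟨υ⁻¹Z⟩ = (𝓘⟨Z⟩.comap υ).radical`
(`vanishingIdeal_preimage`, Literature StalkIdealLemmas) finishes.

References: [cite: StacksProject, Tag 0BIQ]; [cite: Liu2002, Thm. 8.1.19 (b)]. Tree inputs as named.
-/

set_option linter.dupNamespace false -- mandated namespace `Summit.<Summit>.<Problem>` of this single-conjunct summit

noncomputable section

open CategoryTheory AlgebraicGeometry TopologicalSpace IsLocalRing
open Literature.AlgebraicGeometry.Resolution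
open AlgebraicGeometry.Scheme.IdealSheafData

namespace Summit.ResolutionOfSingularities.ResolutionOfSingularities.Cruxes.EquisingularLiftNat.Sections

universe u

/-- The extension of a radical ideal to a localisation is radical. [folklore] -/
theorem isRadical_map_of_isLocalization {B : Type u} [CommRing B] (M : Submonoid B) (S : Type u) [CommRing S] [Algebra B S]
    [IsLocalization M S] {I : Ideal B} (hI : I.IsRadical) : (I.map (algebraMap B S)).IsRadical := by
  intro x hx
  rw [← IsLocalization.map_radical M S I, hI.radical] at hx
  exact hx

/-- Radical ideals transport along ring isomorphisms (image form). [folklore] -/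
theorem isRadical_map_ringEquiv {R S : Type u} [CommRing R] [CommRing S] (e : R ≃+* S) {I : Ideal R} (hI : I.IsRadical) :
    (I.map (e : R →+* S)).IsRadical := by
  rw [Ideal.map_comap_of_equiv]
  exact hI.comap _

/-- If `χ : B → T` becomes the localisation map `B → S` after an isomorphism `e : T ≃ S`, radical ideals of `B` extend to radical
ideals along `χ`. [folklore] -/
theorem isRadical_map_of_isLocalization_of_ringEquiv {B S T : Type u} [CommRing B] [CommRing S] [CommRing T] [Algebra B S]
    (M : Submonoid B) [IsLocalization M S] (e : T ≃+* S) (χ : B →+* T) (hχ : ∀ b, e (χ b) = algebraMap B S b) {J : Ideal B}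
    (hJ : J.IsRadical) : (J.map χ).IsRadical := by
  have hχe : χ = (e.symm : S →+* T).comp (algebraMap B S) :=
    RingHom.ext fun b => by rw [RingHom.comp_apply, RingHom.coe_coe, ← hχ b, RingEquiv.symm_apply_apply]
  rw [hχe, ← Ideal.map_map]
  exact isRadical_map_ringEquiv e.symm (isRadical_map_of_isLocalization M S hJ)

set_option maxHeartbeats 400000 in -- chart algebra `blowupAlgebra` = subalgebra of a localisation: slow unification (as p509910)
/-- **The exceptional ideal of the blow-up of a reduced quasi-regular centre is radical at every point.** [cite: StacksProject, Tag 0BIQ] -/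
theorem isRadical_stalkIdeal_comap_vanishingIdeal {G G' : Scheme.{u}} (υ : G' ⟶ G) (Z : Closeds G)
    (hυ : IsBlowup υ (vanishingIdeal Z))
    (hqr : ∀ z ∈ (Z : Set G), ∃ (r : ℕ) (c : Fin r → G.presheaf.stalk z),
      Ideal.span (Set.range c) = stalkIdeal (vanishingIdeal Z) z ∧ IsQuasiRegular c)
    (x' : G') : (stalkIdeal ((vanishingIdeal Z).comap υ) x').IsRadical := by
  classical
  by_cases hz : υ x' ∈ (Z : Set G)
  · obtain ⟨r, c, hc, hq⟩ := hqr _ hz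
    obtain ⟨j, 𝔔, χ, e, hχ, he, -⟩ :=
      exists_blowupAlgebra_stalk_ringEquiv_of_eq hυ x' c (Ideal.span (Set.range c)) rfl hc
    -- the stalk of the exceptional ideal is `(χ (c_j/1))`
    have hstalkMap : (υ.stalkMap x').hom = χ.comp (algebraMap _ (blowupAlgebra (Ideal.span (Set.range c)) (c j))) :=
      RingHom.ext fun a => (hχ a).symm
    have hE : stalkIdeal ((vanishingIdeal Z).comap υ) x' =
        (Ideal.span {algebraMap _ (blowupAlgebra (Ideal.span (Set.range c)) (c j)) (c j)}).map χ := by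
      rw [stalkIdeal_comap_eq_map_stalkMap, ← hc, hstalkMap, ← Ideal.map_map,
        map_blowupAlgebra_eq_span (Ideal.subset_span (Set.mem_range_self j))]
    -- `B ⧸ (c_j) ≅ (𝒪_{G,z} ⧸ I)[T]` is reduced
    have hIred : IsReduced (G.presheaf.stalk (υ x') ⧸ Ideal.span (Set.range c)) := by
      rw [← Ideal.isRadical_iff_quotient_reduced, hc]
      haveI := ComponentGluing.isReduced_subscheme_vanishingIdeal Z
      exact isRadical_stalkIdeal_of_isReduced_subscheme (vanishingIdeal Z) (υ x')
    have hBred : IsReduced (blowupAlgebra (Ideal.span (Set.range c)) (c j) ⧸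
        Ideal.span {algebraMap _ (blowupAlgebra (Ideal.span (Set.range c)) (c j)) (c j)}) :=
      isReduced_of_injective (blowupAlgebraQuotEquiv c j hq).symm (blowupAlgebraQuotEquiv c j hq).symm.injective
    have hBrad : (Ideal.span {algebraMap _ (blowupAlgebra (Ideal.span (Set.range c)) (c j)) (c j)}).IsRadical :=
      (Ideal.isRadical_iff_quotient_reduced _).mpr hBred
    -- in the localisation `B_𝔔 ≅ 𝒪_{G',x'}`
    rw [hE]
    exact isRadical_map_of_isLocalization_of_ringEquiv (S := Localization.AtPrime 𝔔.asIdeal) 𝔔.asIdeal.primeCompl e χ he hBrad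
  · have hx' : x' ∉ ((vanishingIdeal Z).comap υ).support := by
      rw [support_comap]; exact hz
    rw [stalkIdeal_eq_top_of_not_mem_support hx']
    exact fun _ h => Submodule.mem_top

/-- **The exceptional divisor of the blow-up of a reduced quasi-regular centre is reduced**: `𝓘⟨Z⟩ · 𝒪_{G'} = 𝓘⟨υ⁻¹ Z⟩`.
[cite: StacksProject, Tag 0BIQ] [cite: Liu2002, Thm. 8.1.19 (b)] [OURS · L1 W4.5b] tower assembly, `Tower.Inv₁` (e-i). -/
theorem comap_vanishingIdeal_eq_vanishingIdeal_preimage {G G' : Scheme.{u}} (υ : G' ⟶ G) (Z : Closeds G)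
    (hυ : IsBlowup υ (vanishingIdeal Z))
    (hqr : ∀ z ∈ (Z : Set G), ∃ (r : ℕ) (c : Fin r → G.presheaf.stalk z),
      Ideal.span (Set.range c) = stalkIdeal (vanishingIdeal Z) z ∧ IsQuasiRegular c) :
    (vanishingIdeal Z).comap υ = vanishingIdeal (Z.preimage υ.continuous) := by
  rw [vanishingIdeal_preimage]
  refine ext_of_forall_stalkIdeal_eq fun x' => ?_
  rw [stalkIdeal_radical]
  exact ((isRadical_stalkIdeal_comap_vanishingIdeal υ Z hυ hqr x').radical).symm

/-- The same with the preimage spelled as a set: `𝓘⟨Z⟩.comap υ = 𝓘⟨υ ⁻¹' Z⟩`. [OURS · L1 W4.5b] -/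
theorem comap_vanishingIdeal_eq_vanishingIdeal_preimage' {G G' : Scheme.{u}} (υ : G' ⟶ G) (Z : Set G) (hZ : IsClosed Z)
    (hυ : IsBlowup υ (vanishingIdeal ⟨Z, hZ⟩))
    (hqr : ∀ z ∈ Z, ∃ (r : ℕ) (c : Fin r → G.presheaf.stalk z),
      Ideal.span (Set.range c) = stalkIdeal (vanishingIdeal ⟨Z, hZ⟩) z ∧ IsQuasiRegular c) :
    (vanishingIdeal ⟨Z, hZ⟩).comap υ = vanishingIdeal ⟨υ ⁻¹' Z, hZ.preimage υ.continuous⟩ :=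
  comap_vanishingIdeal_eq_vanishingIdeal_preimage υ ⟨Z, hZ⟩ hυ hqr

end Summit.ResolutionOfSingularities.ResolutionOfSingularities.Cruxes.EquisingularLiftNat.Sections

end
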